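import Literature.Computability.Complexity.Transducers
import Literature.Computability.Complexity.TM2Iterate
import Literature.Computability.Complexity.UnaryArithMachines
import Literature.Computability.Complexity.ProbabilisticClasses
import HarnessLib

/-!
# Coin truncation `⟨u, r⟩ ↦ ⟨u, r ↾ q(|u|)⟩` is polynomial time (trunk CplxCore)

Discharge (D-0014) of the named machine fact `Literature.Computability.Complexity.polyTimeComputable_boolPair_take`
(`ProbabilisticClasses.lean`; Arora–Barak 2009, §1.3 "all polynomials are time constructible",
§0.1 pairing): for every `q : Polynomial ℕ` the string map keeping the first `q(|u|)` symbols of the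
second component of a pair `boolPair u r` is polynomial-time computable.

No new Turing machine is programmed here. The map is assembled from the tree's `FinTM2` toolkit by
composition (`PolyTimeComputable.comp_holds`):

1. the unary clock `evalHdrFn q : z ↦ 1^{|u|} 0 1^{q |u|} 0 z` (`UnaryArithMachines.lean`);
2. a finite-state transducer `markInit` (`Transducers.lean`, `FST.polyTimeComputable_eval`) that drops
   the first unary block, turns the clock block `1^{a}` into the iteration count `none^{a}` and recodes
   every coin `b` of `r` as an *unmarked* pair `0b` — output `none^{a} ++ (boolPair u (marks 0 r)).map some`,
   the input format of the clocked-iteration combinator;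
3. `PolyTimeComputable.iterate_of_le_add` (`TM2Iterate.lean`) applied to the length-preserving
   transducer `markStep`, which marks the first unmarked coin (`0b ↦ 1b`): after `a` rounds exactly the
   first `min a |r|` coins are marked;
4. a transducer `markStrip` erasing the marks and the unmarked coins: output `boolPair u (r ↾ a)`.

Main results: `truncSndFn q ∈ FP` with `truncSndFn q (boolPair u r) = boolPair u (r.take (q |u|))`
(`truncSndFn_boolPair`), and `polyTimeComputable_boolPair_take_holds`; dually `dropSndFn q ∈ FP` with
`dropSndFn q (boolPair u r) = boolPair u (r.drop (q |u|))` (final filter `markRest`). Consumers: the coin-truncation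
normal form of randomized algorithms (`RandAlg.IsPolyTime.truncate`,
`MetaComplexity/HeuristicClassesProofs.lean`) and the closure of the majority operator `pMajority`
(hence of `PP` and of the counting hierarchy) under polynomial-time reductions
(`CountingHierarchyProofs.lean`), where the number of coins `p(|f x|)` has to be cut out of a longer
coin string of length depending on `|x|` only.

## References

* S. Arora, B. Barak, *Computational Complexity: A Modern Approach*, CUP 2009, §0.1 (pairing),
  §1.3 (time-constructible functions; machine constructions), §1.4.1 (clocked simulation), Def. 7.3.
* J. E. Hopcroft, J. D. Ullman, *Introduction to Automata Theory, Languages, and Computation*, 1979,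
  §2.7 (Mealy machines).
-/

namespace Literature.Computability.Complexity

open _root_.Computability

namespace CoinTrunc

/-! ### Marked coin strings -/

/-- `marks k r`: the coin string `r` with each of its first `k` symbols `b` coded as the marked pair
`1b` and each later symbol coded as the unmarked pair `0b`. [folklore] -/
def marks (k : ℕ) (r : List Bool) : List Bool :=
  ((r.take k).flatMap fun b => [true, b]) ++ ((r.drop k).flatMap fun b => [false, b])

/-- `marks k [] = []`. [folklore] -/
@[simp] theorem marks_nil (k : ℕ) : marks k [] = [] := by simp [marks]

/-- No marks: every coin is coded `0b`. [folklore] -/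
@[simp] theorem marks_zero (r : List Bool) : marks 0 r = r.flatMap fun b => [false, b] := by
  simp [marks]

/-- One more mark on a nonempty string. [folklore] -/
@[simp] theorem marks_succ_cons (k : ℕ) (b : Bool) (r : List Bool) :
    marks (k + 1) (b :: r) = true :: b :: marks k r := by
  simp [marks]

/-- Marking at least `|r|` coins marks all of them. [folklore] -/
theorem marks_of_length_le {k : ℕ} {r : List Bool} (h : r.length ≤ k) :
    marks k r = r.flatMap fun b => [true, b] := by
  simp [marks, List.take_of_length_le h, List.drop_of_length_le h]

/-- `boolPair (b :: x) y = b b ⟨x, y⟩`. [Arora–Barak 2009, §0.1] [cite: AroraBarak2009, §0.1] -/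
theorem boolPair_cons (b : Bool) (x y : List Bool) :
    boolPair (b :: x) y = b :: b :: boolPair x y := by
  simp [boolPair]

/-- `boolPair [] y = 0 1 y`. [Arora–Barak 2009, §0.1] [cite: AroraBarak2009, §0.1] -/
theorem boolPair_nil (y : List Bool) : boolPair [] y = false :: true :: y := by
  simp [boolPair]

/-! ### Stage 2: the initial transducer `markInit` -/

/-- States of `markInit`: skipping the first unary block, converting the clock block, then the pair
reader (`ev`: at an even position of `⟨u, r⟩`; `od b`: one symbol `b` pending) and the coin
recoder `tl`. [folklore] -/
inductive S₁
  | skip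
  | cnt
  | ev
  | od (b : Bool)
  | tl
  deriving DecidableEq, Fintype

/-- Transition function of `markInit`. [folklore] -/
def markInitStep : S₁ → Bool → S₁ × List (Option Bool)
  | .skip, true => (.skip, [])
  | .skip, false => (.cnt, [])
  | .cnt, true => (.cnt, [none])
  | .cnt, false => (.ev, [])
  | .ev, b => (.od b, [])
  | .od b, b' => (if b = b' then .ev else .tl, [some b, some b'])
  | .tl, b => (.tl, [some false, some b])

/-- The initial transducer: `1ⁿ 0 1ᵃ 0 ⟨u, r⟩ ↦ none^{a} ++ (⟨u, marks 0 r⟩).map some`. [folklore] -/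
def markInit : FST S₁ Bool (Option Bool) where
  init := .skip
  step := markInitStep
  front := fun _ => []
  keep := fun _ => true

/-- The transition of `markInit` is `markInitStep` (definitional). [folklore] -/
@[simp] theorem markInit_step (s : S₁) (b : Bool) : markInit.step s b = markInitStep s b := rfl

/-- `markInit` keeps its body and prepends nothing: its transduction is the body emitted from the
initial state `skip`. [folklore] -/
@[simp] theorem markInit_eval_eq (w : List Bool) : markInit.eval w = (markInit.run .skip w).2 := by
  simp [FST.eval, markInit]

/-- The body computed by `markInit` from state `ev`, as a plain function (pairs are copied up to
the first unequal pair, after which every symbol `b` becomes `0b`). [folklore] -/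
def evBody : List Bool → List Bool
  | b :: b' :: w => if b = b' then b :: b :: evBody w else b :: b' :: w.flatMap fun c => [false, c]
  | _ => []

/-- The payload/count decomposition of the output of `markInit` on an arbitrary input `w`:
`(evBody w₂, a)` where `w = 1ⁿ 0 w₁`, `w₁ = 1ᵃ 0 w₂` (blocks possibly unterminated). [folklore] -/
def stage2 (w : List Bool) : List Bool × ℕ :=
  (evBody (splitOnes (splitOnes w).2).2, (splitOnes (splitOnes w).2).1)

/-- From state `tl` every symbol `b` is emitted as `0b`. [folklore] -/
theorem markInit_run_tl (w : List Bool) :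
    (markInit.run .tl w).2 = w.flatMap fun c => [some false, some c] := by
  induction w with
  | nil => rfl
  | cons b w ih => simp [FST.run_cons, markInitStep, ih]

/-- From state `ev` the transducer emits `(evBody w).map some`. [folklore] -/
theorem markInit_run_ev : ∀ w : List Bool, (markInit.run .ev w).2 = (evBody w).map some
  | [] => rfl
  | [b] => by simp [FST.run_cons, markInitStep, evBody]
  | b :: b' :: w => by
    by_cases h : b = b'
    · subst h
      simp [FST.run_cons, markInitStep, evBody, markInit_run_ev w]
    · simp [FST.run_cons, markInitStep, evBody, h, markInit_run_tl, List.map_flatMap]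

/-- From state `cnt` the transducer emits the clock as `none`s, then the body. [folklore] -/
theorem markInit_run_cnt (w : List Bool) :
    (markInit.run .cnt w).2 =
      List.replicate (splitOnes w).1 none ++ (evBody (splitOnes w).2).map some := by
  induction w with
  | nil => rfl
  | cons b w ih =>
    cases b
    · simp [FST.run_cons, markInitStep, splitOnes, markInit_run_ev]
    · simp [FST.run_cons, markInitStep, splitOnes, ih, List.replicate_succ]

/-- **Shape of the output of `markInit` on every input**: iteration count in unary (`none`s) followed
by the payload — the input format of `PolyTimeComputable.iterate`. [folklore] -/
theorem markInit_eval (w : List Bool) :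
    markInit.eval w = List.replicate (stage2 w).2 none ++ ((stage2 w).1).map some := by
  have h : ∀ w : List Bool, (markInit.run .skip w).2 =
      List.replicate (stage2 w).2 none ++ ((stage2 w).1).map some := by
    intro w
    induction w with
    | nil => rfl
    | cons b w ih =>
      cases b
      · simp [FST.run_cons, markInitStep, stage2, splitOnes, markInit_run_cnt]
      · simpa [FST.run_cons, markInitStep, stage2, splitOnes] using ih
  rw [markInit_eval_eq, h w]

/-- `evBody ⟨u, r⟩ = ⟨u, marks 0 r⟩`. [folklore] -/
theorem evBody_boolPair (u r : List Bool) : evBody (boolPair u r) = boolPair u (marks 0 r) := by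
  induction u with
  | nil => simp [boolPair_nil, evBody]
  | cons b u ih => simp [boolPair_cons, evBody, ih]

/-- On a well-formed input `1ⁿ 0 1ᵃ 0 ⟨u, r⟩` the decomposition is `(⟨u, marks 0 r⟩, a)`. [folklore] -/
theorem stage2_hdr (n a : ℕ) (u r : List Bool) :
    stage2 (hdr n a (boolPair u r)) = (boolPair u (marks 0 r), a) := by
  simp [stage2, hdr, evBody_boolPair]

/-- `stage2` is polynomial-time computable into the input encoding of the iteration combinator
(it is computed by the transducer `markInit`). [folklore] -/
theorem polyTimeComputable_stage2 :
    PolyTimeComputable (id : List Bool → List Bool)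
      (fun q : List Bool × ℕ => List.replicate q.2 none ++ (id q.1).map some) stage2 := by
  obtain ⟨p, M, hM⟩ := markInit.polyTimeComputable_eval
  refine ⟨p, M, fun w => ?_⟩
  have h := hM w
  simp only [id, markInit_eval] at h ⊢
  exact h

/-! ### Stage 3: one marking round `markStep` -/

/-- States of `markStep`: pair reader (`ev`, `od b`), marked-coin copier (`tev`, `tod m`), and the
verbatim copier after the newly marked coin (`cev`, `cod b`). [folklore] -/
inductive S₃
  | ev
  | od (b : Bool)
  | tev
  | tod (m : Bool)
  | cev
  | cod (b : Bool)
  deriving DecidableEq, Fintype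

/-- Transition function of `markStep`. [folklore] -/
def markStepStep : S₃ → Bool → S₃ × List Bool
  | .ev, b => (.od b, [])
  | .od b, b' => (if b = b' then .ev else .tev, [b, b'])
  | .tev, m => (.tod m, [])
  | .tod true, b => (.tev, [true, b])
  | .tod false, b => (.cev, [true, b])
  | .cev, b => (.cod b, [])
  | .cod b, b' => (.cev, [b, b'])

/-- One marking round: copy `⟨u, ·⟩`, copy the marked coins `1b`, turn the first unmarked coin `0b`
into `1b`, copy the rest. [folklore] -/
def markStep : FST S₃ Bool Bool where
  init := .ev
  step := markStepStep
  front := fun _ => []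
  keep := fun _ => true

/-- The transition of `markStep` is `markStepStep` (definitional). [folklore] -/
@[simp] theorem markStep_step (s : S₃) (b : Bool) : markStep.step s b = markStepStep s b := rfl

/-- The transduction of `markStep` is the body emitted from the initial state `ev`. [folklore] -/
@[simp] theorem markStep_eval_eq (w : List Bool) : markStep.eval w = (markStep.run .ev w).2 := by
  simp [FST.eval, markStep]

/-- The verbatim copier copies pair-coded strings. [folklore] -/
theorem markStep_run_cev (m : Bool) (l : List Bool) :
    (markStep.run .cev (l.flatMap fun c => [m, c])).2 = l.flatMap fun c => [m, c] := by
  induction l with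
  | nil => rfl
  | cons b l ih => simp [FST.run_cons, markStepStep, ih]

/-- One round on the coin region marks one more coin (saturating at `|r|`). [folklore] -/
theorem markStep_run_tev (r : List Bool) :
    ∀ k : ℕ, (markStep.run .tev (marks k r)).2 = marks (min (k + 1) r.length) r := by
  induction r with
  | nil => intro k; simp
  | cons b r ih =>
    intro k
    cases k with
    | zero =>
      simp [FST.run_cons, markStepStep, markStep_run_cev, List.flatMap_cons]
    | succ k =>
      have hmin : min (k + 1 + 1) (r.length + 1) = min (k + 1) r.length + 1 := by omega
      simp [FST.run_cons, markStepStep, ih k, hmin]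

/-- The pair reader copies the first component and the separator. [folklore] -/
theorem markStep_run_ev (u w : List Bool) :
    (markStep.run .ev (boolPair u w)).2 = boolPair u (markStep.run .tev w).2 := by
  induction u with
  | nil => simp [boolPair_nil, FST.run_cons, markStepStep]
  | cons b u ih => simp [boolPair_cons, FST.run_cons, markStepStep, ih]

/-- **One marking round**: `markStep ⟨u, marks k r⟩ = ⟨u, marks (min (k+1) |r|) r⟩`. [folklore] -/
theorem markStep_eval_marks (u : List Bool) (k : ℕ) (r : List Bool) :
    markStep.eval (boolPair u (marks k r)) = boolPair u (marks (min (k + 1) r.length) r) := by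
  rw [markStep_eval_eq, markStep_run_ev, markStep_run_tev]

/-- **`a` marking rounds** mark exactly the first `min a |r|` coins. [folklore] -/
theorem markStep_iterate_marks (u r : List Bool) (a : ℕ) :
    markStep.eval^[a] (boolPair u (marks 0 r)) = boolPair u (marks (min a r.length) r) := by
  induction a with
  | zero => simp
  | succ a ih =>
    rw [Function.iterate_succ_apply', ih, markStep_eval_marks]
    congr 2
    omega

/-- Number of input symbols pending in a state of `markStep` (not yet re-emitted). [folklore] -/
def S₃.pending : S₃ → ℕ
  | .od _ => 1
  | .tod _ => 1
  | .cod _ => 1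
  | _ => 0

/-- `markStep` never lengthens its input: `|body| ≤ |w| + pending s` from every state `s`. [folklore] -/
theorem markStep_length_run_le (w : List Bool) :
    ∀ s : S₃, (markStep.run s w).2.length ≤ w.length + s.pending := by
  induction w with
  | nil => intro s; simp
  | cons b w ih =>
    intro s
    rcases s with _ | b' | _ | m | _ | b'
    · simpa [FST.run_cons, markStepStep, S₃.pending] using ih (.od b)
    · by_cases h : b' = b
      · subst h
        have := ih .ev
        simp [FST.run_cons, markStepStep, S₃.pending] at this ⊢
        omega
      · have := ih .tev
        simp [FST.run_cons, markStepStep, S₃.pending, h] at this ⊢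
        omega
    · simpa [FST.run_cons, markStepStep, S₃.pending] using ih (.tod b)
    · cases m
      · have := ih .cev
        simp [FST.run_cons, markStepStep, S₃.pending] at this ⊢
        omega
      · have := ih .tev
        simp [FST.run_cons, markStepStep, S₃.pending] at this ⊢
        omega
    · simpa [FST.run_cons, markStepStep, S₃.pending] using ih (.cod b)
    · have := ih .cev
      simp [FST.run_cons, markStepStep, S₃.pending] at this ⊢
      omega

/-- `|markStep w| ≤ |w|` for every input `w` (the additive-growth hypothesis, with `d = 0`, of
`PolyTimeComputable.iterate_of_le_add`). [folklore] -/
theorem length_markStep_eval_le (w : List Bool) : (markStep.eval w).length ≤ w.length := by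
  simpa [S₃.pending] using markStep_length_run_le w .ev

/-- **Clocked marking is polynomial time**: `(s, a) ↦ markStep^{a} s` on the input
`none^{a} ++ s.map some` (`PolyTimeComputable.iterate_of_le_add` with the transducer machine of
`markStep`). [Arora–Barak 2009, §1.4.1] [cite: AroraBarak2009, §1.4.1] -/
theorem polyTimeComputable_iterate_markStep :
    PolyTimeComputable (fun q : List Bool × ℕ => List.replicate q.2 none ++ (id q.1).map some)
      (id : List Bool → List Bool) (fun q => markStep.eval^[q.2] q.1) :=
  PolyTimeComputable.iterate_of_le_add (ea := (id : List Bool → List Bool)) 0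
    (fun w => by simpa using length_markStep_eval_le w) markStep.polyTimeComputable_eval

/-! ### Stage 4: erasing marks and unmarked coins, `markStrip` -/

/-- States of `markStrip`: pair reader (`ev`, `od b`) and coin filter (`tev`, `tod m`). [folklore] -/
inductive S₄
  | ev
  | od (b : Bool)
  | tev
  | tod (m : Bool)
  deriving DecidableEq, Fintype

/-- Transition function of `markStrip`. [folklore] -/
def markStripStep : S₄ → Bool → S₄ × List Bool
  | .ev, b => (.od b, [])
  | .od b, b' => (if b = b' then .ev else .tev, [b, b'])
  | .tev, m => (.tod m, [])
  | .tod true, b => (.tev, [b])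
  | .tod false, _ => (.tev, [])

/-- The final transducer: copy `⟨u, ·⟩`, emit `b` for each marked coin `1b`, drop each unmarked coin
`0b`. [folklore] -/
def markStrip : FST S₄ Bool Bool where
  init := .ev
  step := markStripStep
  front := fun _ => []
  keep := fun _ => true

/-- The transition of `markStrip` is `markStripStep` (definitional). [folklore] -/
@[simp] theorem markStrip_step (s : S₄) (b : Bool) : markStrip.step s b = markStripStep s b := rfl

/-- The transduction of `markStrip` is the body emitted from the initial state `ev`. [folklore] -/
@[simp] theorem markStrip_eval_eq (w : List Bool) : markStrip.eval w = (markStrip.run .ev w).2 := by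
  simp [FST.eval, markStrip]

/-- On the coin region `markStrip` returns the marked prefix. [folklore] -/
theorem markStrip_run_tev (r : List Bool) :
    ∀ k : ℕ, (markStrip.run .tev (marks k r)).2 = r.take k := by
  induction r with
  | nil => intro k; simp
  | cons b r ih =>
    intro k
    cases k with
    | zero =>
      have h0 : ∀ l : List Bool,
          (markStrip.run .tev (l.flatMap fun c => [false, c])).2 = [] := by
        intro l
        induction l with
        | nil => rfl
        | cons c l ihl => simp [FST.run_cons, markStripStep, ihl]
      simpa using h0 (b :: r)
    | succ k => simp [FST.run_cons, markStripStep, ih k]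

/-- The pair reader of `markStrip` copies the first component and the separator. [folklore] -/
theorem markStrip_run_ev (u w : List Bool) :
    (markStrip.run .ev (boolPair u w)).2 = boolPair u (markStrip.run .tev w).2 := by
  induction u with
  | nil => simp [boolPair_nil, FST.run_cons, markStripStep]
  | cons b u ih => simp [boolPair_cons, FST.run_cons, markStripStep, ih]

/-- **`markStrip ⟨u, marks k r⟩ = ⟨u, r ↾ k⟩`.** [folklore] -/
theorem markStrip_eval_marks (u : List Bool) (k : ℕ) (r : List Bool) :
    markStrip.eval (boolPair u (marks k r)) = boolPair u (r.take k) := by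
  rw [markStrip_eval_eq, markStrip_run_ev, markStrip_run_tev]

end CoinTrunc

open CoinTrunc

/-! ### The truncation map and the discharge -/

/-- **The coin-truncation map** `truncSndFn q`, a total string function with
`truncSndFn q ⟨u, r⟩ = ⟨u, r ↾ q(|u|)⟩` (`truncSndFn_boolPair`): unary clock, initial recoding,
`q(|u|)` clocked marking rounds, final filter. [Arora–Barak 2009, §1.3, Def. 7.3] [cite: AroraBarak2009, §1.3] -/
noncomputable def truncSndFn (q : Polynomial ℕ) : List Bool → List Bool :=
  markStrip.eval ∘ (fun s : List Bool × ℕ => markStep.eval^[s.2] s.1) ∘ stage2 ∘ evalHdrFn q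

/-- **`truncSndFn q ⟨u, r⟩ = ⟨u, r ↾ q(|u|)⟩`.** [Arora–Barak 2009, Def. 7.3] [cite: AroraBarak2009, Def. 7.3] -/
theorem truncSndFn_boolPair (q : Polynomial ℕ) (u r : List Bool) :
    truncSndFn q (boolPair u r) = boolPair u (r.take (q.eval u.length)) := by
  simp only [truncSndFn, Function.comp_apply, evalHdrFn, boolUnpair_boolPair, stage2_hdr,
    markStep_iterate_marks, markStrip_eval_marks]
  rw [← List.take_take, List.take_length]

/-- **The coin-truncation map is in `FP`** (composition of the four polynomial-time stages,
`PolyTimeComputable.comp_holds`). [Arora–Barak 2009, §1.3 ("all polynomials are time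
constructible"), Thm. 2.8 (proof: composition)] [cite: AroraBarak2009, §1.3] -/
theorem truncSndFn_mem_FP (q : Polynomial ℕ) : truncSndFn q ∈ FP :=
  PolyTimeComputable.comp_holds markStrip.polyTimeComputable_eval
    (PolyTimeComputable.comp_holds polyTimeComputable_iterate_markStep
      (PolyTimeComputable.comp_holds polyTimeComputable_stage2 (evalHdrFn_mem_FP q)))

/-- **Discharge of `polyTimeComputable_boolPair_take`** (`ProbabilisticClasses.lean`): for every
polynomial `q`, `⟨u, r⟩ ↦ ⟨u, r ↾ q(|u|)⟩` is polynomial-time computable w.r.t. the pairing `boolPair`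
on both sides — transport of `truncSndFn_mem_FP` along `truncSndFn_boolPair`. [Arora–Barak 2009,
§1.3 and §0.1] [cite: AroraBarak2009, §1.3] -/
theorem polyTimeComputable_boolPair_take_holds : polyTimeComputable_boolPair_take := by
  intro q
  obtain ⟨p, M, hM⟩ := truncSndFn_mem_FP q
  refine ⟨p, M, fun pr => ?_⟩
  have h := hM (boolPair pr.1 pr.2)
  simp only [id, truncSndFn_boolPair] at h
  exact h

/-! ### Keeping the *remaining* coins: `⟨u, r⟩ ↦ ⟨u, r.drop (q |u|)⟩` -/

namespace CoinTrunc

/-- Transition function of `markRest`: copy `⟨u, ·⟩`, drop each marked coin `1b`, emit `b` for each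
unmarked coin `0b` (the complement of `markStrip`). [folklore] -/
def markRestStep : S₄ → Bool → S₄ × List Bool
  | .ev, b => (.od b, [])
  | .od b, b' => (if b = b' then .ev else .tev, [b, b'])
  | .tev, m => (.tod m, [])
  | .tod true, _ => (.tev, [])
  | .tod false, b => (.tev, [b])

/-- The final transducer for the suffix: `⟨u, marks k r⟩ ↦ ⟨u, r.drop k⟩`. [folklore] -/
def markRest : FST S₄ Bool Bool where
  init := .ev
  step := markRestStep
  front := fun _ => []
  keep := fun _ => true

/-- The transition of `markRest` is `markRestStep` (definitional). [folklore] -/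
@[simp] theorem markRest_step (s : S₄) (b : Bool) : markRest.step s b = markRestStep s b := rfl

/-- The transduction of `markRest` is the body emitted from the initial state `ev`. [folklore] -/
@[simp] theorem markRest_eval_eq (w : List Bool) : markRest.eval w = (markRest.run .ev w).2 := by
  simp [FST.eval, markRest]

/-- On the coin region `markRest` returns the unmarked suffix. [folklore] -/
theorem markRest_run_tev (r : List Bool) :
    ∀ k : ℕ, (markRest.run .tev (marks k r)).2 = r.drop k := by
  induction r with
  | nil => intro k; simp
  | cons b r ih =>
    intro k
    cases k with
    | zero =>
      have h0 : ∀ l : List Bool,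
          (markRest.run .tev (l.flatMap fun c => [false, c])).2 = l := by
        intro l
        induction l with
        | nil => rfl
        | cons c l ihl => simp [FST.run_cons, markRestStep, ihl]
      simpa using h0 (b :: r)
    | succ k => simp [FST.run_cons, markRestStep, ih k]

/-- The pair reader of `markRest` copies the first component and the separator. [folklore] -/
theorem markRest_run_ev (u w : List Bool) :
    (markRest.run .ev (boolPair u w)).2 = boolPair u (markRest.run .tev w).2 := by
  induction u with
  | nil => simp [boolPair_nil, FST.run_cons, markRestStep]
  | cons b u ih => simp [boolPair_cons, FST.run_cons, markRestStep, ih]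

/-- **`markRest ⟨u, marks k r⟩ = ⟨u, r.drop k⟩`.** [folklore] -/
theorem markRest_eval_marks (u : List Bool) (k : ℕ) (r : List Bool) :
    markRest.eval (boolPair u (marks k r)) = boolPair u (r.drop k) := by
  rw [markRest_eval_eq, markRest_run_ev, markRest_run_tev]

end CoinTrunc

/-- **The coin-suffix map** `dropSndFn q`, with `dropSndFn q ⟨u, r⟩ = ⟨u, r.drop (q |u|)⟩`
(`dropSndFn_boolPair`): the same pipeline as `truncSndFn` with the complementary final filter (used
to split a coin string into two independent halves, e.g. for `RP ⊆ BPP`). [Arora–Barak 2009,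
§7.4.1 (independent repetitions)] [cite: AroraBarak2009, §7.4.1] -/
noncomputable def dropSndFn (q : Polynomial ℕ) : List Bool → List Bool :=
  markRest.eval ∘ (fun s : List Bool × ℕ => markStep.eval^[s.2] s.1) ∘ stage2 ∘ evalHdrFn q

/-- **`dropSndFn q ⟨u, r⟩ = ⟨u, r.drop (q |u|)⟩`.** [Arora–Barak 2009, §7.4.1] [cite: AroraBarak2009, §7.4.1] -/
theorem dropSndFn_boolPair (q : Polynomial ℕ) (u r : List Bool) :
    dropSndFn q (boolPair u r) = boolPair u (r.drop (q.eval u.length)) := by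
  simp only [dropSndFn, Function.comp_apply, evalHdrFn, boolUnpair_boolPair, stage2_hdr,
    markStep_iterate_marks, markRest_eval_marks]
  congr 1
  by_cases h : q.eval u.length ≤ r.length
  · rw [min_eq_left h]
  · have h' : r.length ≤ q.eval u.length := by omega
    rw [min_eq_right h', List.drop_length, List.drop_of_length_le h']

/-- **The coin-suffix map is in `FP`.** [Arora–Barak 2009, §1.3, Thm. 2.8 (proof)] [cite: AroraBarak2009, §1.3] -/
theorem dropSndFn_mem_FP (q : Polynomial ℕ) : dropSndFn q ∈ FP :=
  PolyTimeComputable.comp_holds markRest.polyTimeComputable_eval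
    (PolyTimeComputable.comp_holds polyTimeComputable_iterate_markStep
      (PolyTimeComputable.comp_holds polyTimeComputable_stage2 (evalHdrFn_mem_FP q)))

end Literature.Computability.Complexity
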